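import Literature.AlgebraicGeometry.Frobenioids.Monoids
import Literature.AlgebraicGeometry.Frobenioids.ElementaryFrobenioid
import Mathlib.Algebra.Group.TypeTags.Basic
import Mathlib.Data.ZMod.Defs
import HarnessLib

/-!
# Frobenioids I, §0 "Monoids" and Def. 1.1 (i): *sharp*, *integral*, *of characteristic type*,
# *primary*, `≼` — Mathlib bindings, the author's erratum (30) «'of characteristic type' is automatic»
# PROVED, instance witnesses, and the kernel status of the five predicates as FACT-LIST rows

Mochizuki, *The geometry of Frobenioids I: the general theory*, Kyushu J. Math. **62** (2008)
293–400, §0 "Monoids", kurims text pp. 11–12 [cite: MochizukiFrdI2008, §0 p.11], Definition 1.1 (i)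
p. 19 [cite: MochizukiFrdI2008, Def. 1.1 (i) p.19]; and the author's *Comments* (January 2024), item
(30): "In Definition 1.1, (i), the condition 'of characteristic type' is automatic and hence may be
omitted" [cite: MochizukiFrdIComments2024, (30)].

PROOF-ONLY companion of `Monoids.lean` / `ElementaryFrobenioid.lean` (abc-iut cell, block F
fact-proving wave; FACT-LIST rows F-2362 `IsSharp`, F-2363 `IsIntegral`, F-2366 `IsOfCharType`,
F-1126 `IsPrimary`, F-1128 `Precsim` — all of them §0 DEFINITIONS, i.e. hypothesis predicates switched
on per sentence, not closed published facts).  In kernel: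

* **Erratum (30) PROVED**: an integral (= cancellative, `isIntegral_iff_isCancelMul`) commutative monoid
  is of characteristic type (`IsIntegral.isOfCharType`), so "pre-divisorial" = integral ∧ saturated
  (`isPreDivisorial_of_isIntegral_of_isSaturated`, `isPreDivisorial_iff`);
* bindings / instance forms: `IsSharp M ↔ Subsingleton Mˣ` (`isSharp_iff_subsingleton_units`); groups
  and cancellative monoids are of characteristic type; `(ℕ, +)` is sharp and integral; `1` (the paper's
  `0`) is never primary and `a ≼ 1` forces `a = 1`;
* **the UNIVERSAL CLOSURES of the five rows are FALSE as typed** (so the rows are schemata, consumable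
  in instance form only — refuting OUR universal closure is not a statement about print): `(ℤ, +)` is
  not sharp; `ZMod 2` (multiplicatively) is not integral; `ZMod 3` is not of characteristic type (the
  unit `2 = −1` fixes `0`); `1` is not primary; `ofAdd 1 ⋠ 1` in `(ℕ, +)`.

No statement of the paper is strengthened; nothing here is specific to the abc programme.
-/

namespace Literature.AlgebraicGeometry.Frobenioids

open Function

universe u

variable {M : Type u} [CommMonoid M]

/-! ### `IsSharp` (FACT-LIST F-2362) -/

/-- Binding: `M` is sharp (FrdI §0 p. 11, `M^± = 0`) iff its unit group is trivial.
[cite: MochizukiFrdI2008, §0 p.11] -/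
theorem isSharp_iff_subsingleton_units : IsSharp M ↔ Subsingleton Mˣ := by
  rw [isSharp_iff]
  refine ⟨fun h => ⟨fun u v => Units.ext ((h u u.isUnit).trans (h v v.isUnit).symm)⟩, fun h a ha => ?_⟩
  obtain ⟨u, rfl⟩ := ha
  rw [Subsingleton.elim u 1, Units.val_one]

/-- In a sharp monoid every unit is `1`. [cite: MochizukiFrdI2008, §0 p.11] -/
theorem IsSharp.units_eq_one (h : IsSharp M) (u : Mˣ) : u = 1 :=
  Units.ext (h.eq_one_of_isUnit u u.isUnit)

/-- A monoid with trivial unit group is sharp (instance form of the binding).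
[cite: MochizukiFrdI2008, §0 p.11] -/
theorem isSharp_of_subsingleton_units [Subsingleton Mˣ] : IsSharp M :=
  isSharp_iff_subsingleton_units.mpr ‹_›

/-- Instance witness: `(ℕ, +)` (multiplicatively) is sharp. [cite: MochizukiFrdI2008, §0 p.11] -/
theorem isSharp_multiplicative_nat : IsSharp (Multiplicative ℕ) :=
  ⟨fun a ha => by
    obtain ⟨u, rfl⟩ := ha
    have h : (u : Multiplicative ℕ).toAdd + ((u⁻¹ : (Multiplicative ℕ)ˣ) : Multiplicative ℕ).toAdd = 0 := by
      rw [← toAdd_mul, Units.mul_inv, toAdd_one]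
    exact Multiplicative.toAdd.injective (Nat.eq_zero_of_add_eq_zero_right h)⟩

/-- `(ℤ, +)` (multiplicatively) is NOT sharp: `1` is a non-trivial unit.
[cite: MochizukiFrdI2008, §0 p.11] -/
theorem not_isSharp_multiplicative_int : ¬ IsSharp (Multiplicative ℤ) := fun h =>
  absurd (congrArg Multiplicative.toAdd (h.eq_one_of_isUnit (Multiplicative.ofAdd (1 : ℤ)) (Group.isUnit _)))
    (by decide)

/-- **The universal closure of FACT-LIST row F-2362 is false**: "every commutative monoid is sharp"
fails at `(ℤ, +)`.  `IsSharp` is a hypothesis predicate (FrdI §0 p. 11); this refutes OUR universal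
closure, not a statement of the paper. [cite: MochizukiFrdI2008, §0 p.11] -/
theorem not_forall_isSharp : ¬ ∀ (M : Type) [CommMonoid M], IsSharp M := fun h =>
  not_isSharp_multiplicative_int (h _)

/-! ### `IsIntegral` (FACT-LIST F-2363) -/

/-- Instance form: a cancellative commutative monoid is integral (the binding
`isIntegral_iff_isCancelMul` of `Monoids.lean`, instance direction). [cite: MochizukiFrdI2008, §0 p.11] -/
theorem isIntegral_of_isCancelMul [IsCancelMul M] : IsIntegral M :=
  isIntegral_iff_isCancelMul.mpr ‹_›

/-- Instance witness: `(ℕ, +)` (multiplicatively) is integral. [cite: MochizukiFrdI2008, §0 p.11] -/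
theorem isIntegral_multiplicative_nat : IsIntegral (Multiplicative ℕ) :=
  isIntegral_of_isCancelMul

/-- `ZMod 2`, as a multiplicative commutative monoid, is NOT integral: `0 · 0 = 0 · 1` but `0 ≠ 1`, so
it is not cancellative and `M → M^gp` (here `M^gp = 0`) is not injective. [cite: MochizukiFrdI2008, §0 p.11] -/
theorem not_isIntegral_zmod_two : ¬ IsIntegral (ZMod 2) := fun h => by
  haveI := isIntegral_iff_isCancelMul.mp h
  exact absurd (mul_left_cancel (show (0 : ZMod 2) * 0 = 0 * 1 by decide)) (by decide)

/-- **The universal closure of FACT-LIST row F-2363 is false**: "every commutative monoid is integral"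
fails at `ZMod 2`.  `IsIntegral` is a hypothesis predicate (FrdI §0 p. 11); this refutes OUR
universal closure, not a statement of the paper. [cite: MochizukiFrdI2008, §0 p.11] -/
theorem not_forall_isIntegral : ¬ ∀ (M : Type) [CommMonoid M], IsIntegral M := fun h =>
  not_isIntegral_zmod_two (h _)

/-! ### `IsOfCharType` (FACT-LIST F-2366) and the erratum (30) -/

/-- A (left-)cancellative commutative monoid is of characteristic type: `u · a = a = 1 · a` forces
`u = 1`. [cite: MochizukiFrdI2008, §0 p.11] -/
theorem isOfCharType_of_isCancelMul [IsCancelMul M] : IsOfCharType M :=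
  ⟨fun _ a h => Units.ext (mul_right_cancel (h.trans (one_mul a).symm))⟩

/-- **[FrdI] Comments (January 2024), item (30), PROVED**: "In Definition 1.1, (i), the condition 'of
characteristic type' is automatic" — an integral commutative monoid is of characteristic type (integral
= cancellative, and cancelling `a` in `u · a = a` gives `u = 1`).
[cite: MochizukiFrdI2008, Def. 1.1 (i) p.19; MochizukiFrdIComments2024, (30)] -/
theorem IsIntegral.isOfCharType (h : IsIntegral M) : IsOfCharType M := by
  haveI := isIntegral_iff_isCancelMul.mp h
  exact isOfCharType_of_isCancelMul

/-- **Def. 1.1 (i) with the erratum (30) applied**: `M` is pre-divisorial as soon as it is integral and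
saturated. [cite: MochizukiFrdI2008, Def. 1.1 (i) p.19; MochizukiFrdIComments2024, (30)] -/
theorem isPreDivisorial_of_isIntegral_of_isSaturated (h₁ : IsIntegral M) (h₂ : IsSaturated M) :
    IsPreDivisorial M :=
  ⟨h₁, h₂, h₁.isOfCharType⟩

/-- **Def. 1.1 (i) with the erratum (30) applied**, `iff` form: pre-divisorial ⟺ integral ∧ saturated.
[cite: MochizukiFrdI2008, Def. 1.1 (i) p.19; MochizukiFrdIComments2024, (30)] -/
theorem isPreDivisorial_iff : IsPreDivisorial M ↔ IsIntegral M ∧ IsSaturated M :=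
  ⟨fun h => ⟨h.isIntegral, h.isSaturated⟩, fun h => isPreDivisorial_of_isIntegral_of_isSaturated h.1 h.2⟩

/-- Instance form: a commutative GROUP is of characteristic type. [cite: MochizukiFrdI2008, §0 p.11] -/
theorem isOfCharType_of_commGroup {G : Type u} [CommGroup G] : IsOfCharType G :=
  isOfCharType_of_isCancelMul

/-- `ZMod 3`, as a multiplicative commutative monoid, is NOT of characteristic type: the unit `2`
(`= −1`) fixes `0` (`2 · 0 = 0`) but `2 ≠ 1` — the unit action on the fibre of `0` in `M^char` is not
free. [cite: MochizukiFrdI2008, §0 p.11] -/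
theorem not_isOfCharType_zmod_three : ¬ IsOfCharType (ZMod 3) := fun h => by
  have hu : IsUnit (2 : ZMod 3) := isUnit_iff_exists_inv.mpr ⟨2, by decide⟩
  obtain ⟨u, hu'⟩ := hu
  have h1 := h.eq_one_of_mul_eq u 0 (mul_zero _)
  rw [h1, Units.val_one] at hu'
  exact absurd hu' (by decide)

/-- **The universal closure of FACT-LIST row F-2366 is false**: "every commutative monoid is of
characteristic type" fails at `ZMod 3`.  `IsOfCharType` is a hypothesis predicate (FrdI §0 p. 11; by
the erratum (30) it is implied by "integral"); this refutes OUR universal closure, not a statement of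
the paper. [cite: MochizukiFrdI2008, §0 p.11] -/
theorem not_forall_isOfCharType : ¬ ∀ (M : Type) [CommMonoid M], IsOfCharType M := fun h =>
  not_isOfCharType_zmod_three (h _)

/-! ### `Precsim` (FACT-LIST F-1128) and `IsPrimary` (FACT-LIST F-1126) -/

/-- `a ≼ 1` forces `a = 1` in a sharp monoid (`a ∣ 1 ^ n = 1` makes `a` a unit).
[cite: MochizukiFrdI2008, §0 p.12] -/
theorem eq_one_of_precsim_one (hM : IsSharp M) {a : M} (h : a ≼ 1) : a = 1 := by
  obtain ⟨n, -, hn⟩ := h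
  rw [one_pow] at hn
  exact hM.eq_one_of_isUnit a (isUnit_of_dvd_one hn)

/-- In `(ℕ, +)` (multiplicatively), `ofAdd 1 ⋠ 1`: `1 ≤ n · 0` fails for every `n`.
[cite: MochizukiFrdI2008, §0 p.12] -/
theorem not_precsim_ofAdd_one_one : ¬ ((Multiplicative.ofAdd (1 : ℕ)) ≼ (1 : Multiplicative ℕ)) :=
  fun h => absurd (congrArg Multiplicative.toAdd (eq_one_of_precsim_one isSharp_multiplicative_nat h))
    (by decide)

/-- **The universal closure of FACT-LIST row F-1128 is false**: "`a ≼ b` for all `a, b`" fails at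
`a = 1 ∈ ℕ`, `b = 0 ∈ ℕ` (additively).  `Precsim` is a RELATION defined in FrdI §0 p. 12, not a fact;
its printed properties (reflexive, transitive, monotone under morphisms, …) are PROVED in `Monoids.lean`
(`precsim_refl`, `Precsim.trans`, `Precsim.map`, …). [cite: MochizukiFrdI2008, §0 p.12] -/
theorem not_forall_precsim : ¬ ∀ (M : Type) [CommMonoid M] (a b : M), a ≼ b := fun h =>
  not_precsim_ofAdd_one_one (h _ _ _)

/-- `1` (the paper's `0`) is never primary: primary elements are non-zero by definition (FrdI §0 p. 12,
"`0 ≠ a ∈ M` is primary if …"). [cite: MochizukiFrdI2008, §0 p.12] -/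
theorem not_isPrimary_one : ¬ IsPrimary (1 : M) := fun h => h.1 rfl

/-- Instance witness: in `(ℕ, +)` (multiplicatively) the element `1` (`ofAdd 1`) is primary — every
non-zero `b` satisfies `1 ≼ b` (indeed `1 ≤ b`). [cite: MochizukiFrdI2008, §0 p.12] -/
theorem isPrimary_ofAdd_one_nat : IsPrimary (Multiplicative.ofAdd (1 : ℕ)) := by
  refine ⟨fun h => absurd (congrArg Multiplicative.toAdd h) (by decide), fun b hb _ => ⟨1, one_pos, ?_⟩⟩
  rw [pow_one]
  refine ⟨Multiplicative.ofAdd (b.toAdd - 1), ?_⟩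
  apply Multiplicative.toAdd.injective
  rw [toAdd_mul, toAdd_ofAdd, toAdd_ofAdd]
  have hb' : b.toAdd ≠ 0 := fun h0 => hb (Multiplicative.toAdd.injective h0)
  omega

/-- **The universal closure of FACT-LIST row F-1126 is false**: "every element of every commutative
monoid is primary" fails at `1` (any monoid).  `IsPrimary` is a DEFINITION (FrdI §0 p. 12); its printed
properties are PROVED in `Monoids.lean` (`IsPrimary.of_precsim`, `IsPrimary.pow`,
`precsim_equivalence_on_primaries`, …). [cite: MochizukiFrdI2008, §0 p.12] -/
theorem not_forall_isPrimary : ¬ ∀ (M : Type) [CommMonoid M] (a : M), IsPrimary a := fun h =>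
  not_isPrimary_one (h (Multiplicative ℕ) 1)

end Literature.AlgebraicGeometry.Frobenioids
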